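import Summits.ABC.ABC.Theorems.IsogenyGlueCongruenceModularDatumExistsUniformLifting
import HarnessLib

/-!
# Crux `ModularDatumExists` (stmt-ABC-15126), line `Sketch` (card `uniform-lifting-recut`): skeleton

Lead prover's skeleton for the crux
`Summit.ABC.ABC.Theses.IsogenyGlueCongruence.ModularDatumExists` (every elliptic `W/ℚ` in a
globally minimal model carries a `ModularParametrizationData` at level `N_W`; unconditionally
equivalent to the Modularity Theorem `exists_isNewformOf`, i.e. to `∀ W, BCDT.IsModular W`,
`Summit.ABC.ABC.Theorems.modularDatumExists_iff_forall_isModular`, p91952).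

Line `Sketch` = Wiles' case analysis in CDT's p. 556 order, cut through ONE weight-two modularity
lifting schema at `p = 3` and `p = 5` (Dieulefait–Pacetti 2023 Thm 1.4 = Kisin 2009), so that no
`27 ∤ N_E`, no tame/wild split at `3`, no Ogg–Saito / Swan conductor leaf and no conductor
transfer along `E'[5] ≅ E[5]` enter the cone.  Five stubs, each a published theorem:

* `stub_modThree`  — `E[3]` absolutely irreducible ⇒ `ρ̄_{E,3}` modular (Langlands–Tunnell; the
  tree's `modThree_of_langlands_tunnell` from the named fact `langlands_tunnell`);
* `stub_liftThree` — LIFT(3): `ρ̄_{E,3}|ℚ(√-3)` abs. irreducible and `ρ̄_{E,3}` modular ⇒ `E`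
  modular (Kisin 2009 / Dieulefait–Pacetti 2023 Thm 1.4 at `p = 3`, `k = 2`; = the tree's
  `CDT_theorem_7_2_1` with `¬ 27 ∣ N_E` deleted and residual modularity made a hypothesis);
* `stub_liftFive`  — LIFT(5) = `CDT_theorem_7_2_2` verbatim (tree fact);
* `stub_switch`    — the `3`–`5` switch, torsion-only (`CDT_three_five_switch` minus its idle
  `¬ 27 ∣ N_E`; implied by the tree fact `exists_isTorsionGaloisRep_five_and_surjective_three`);
* `stub_lemma723`  — `CDT_lemma_7_2_3_isModular` verbatim (tree fact; Elkies).

Composition `ModularDatumExists_of` = the landed `modularDatumExists_of_modThree_of_liftThree_of_CDT722_of_switch_of_CDT723` (p97015) applied to the stubs: (1) some framed `ρ̄_{E,3}`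
abs. irreducible over `ℚ(√-3)` ⇒ modular by `stub_modThree`, `E` modular by `stub_liftThree`;
(2) else fix `ρ̄ = ρ̄_{E,5}`; if `ρ̄|ℚ(√5)` is not abs. irreducible ⇒ `stub_lemma723`; (3) else
`stub_switch` gives `E'` with `E'[5] ≅ E[5]` and `ρ̄_{E',3}|ℚ(√-3)` abs. irreducible ⇒ `E'`
modular by (1) ⇒ `ρ̄` modular (`IsModular.isModular_of_isTorsionGaloisRep''`, proved) ⇒ `E`
modular by `stub_liftFive`; finally `modularDatumExists_iff_forall_isModular`.
-/

set_option linter.dupNamespace false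

noncomputable section

open scoped MatrixGroups
open Literature.NumberTheory.GaloisRepresentations
open Literature.NumberTheory.Automorphic
open Literature.NumberTheory.Automorphic.BCDT
open Literature.NumberTheory.EllipticCurves.ModularForms

namespace Summit.ABC.ABC.Theorems

/-- **Stub (Langlands–Tunnell for `ρ̄_{E,3}`)**: for an elliptic `W/ℚ` and a framed model `ρ̄` of
`E[3]`, `ρ̄` absolutely irreducible ⇒ `ρ̄` modular (`ModPGaloisRep.IsModular`).  In the tree this
is `BCDT.modThree_of_langlands_tunnell hLT` from the named fact `langlands_tunnell` (lang.S30).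
[cite: Gelbart1997, Prop. 1.4] -/
theorem stub_modThree :
    ∀ (W : WeierstrassCurve ℚ) [W.IsElliptic] (ρ : ModPGaloisRep ℚ (ZMod 3) 2),
      W.IsTorsionGaloisRep 3 ρ → FramedRep.IsAbsolutelyIrreducible ρ → ρ.IsModular := by
  sorry

/-- **Stub LIFT(3)** (weight-two potentially semistable modularity lifting at `p = 3` for
`ρ_{E,3}`): for an elliptic `W/ℚ` and a framed model `ρ̄` of `E[3]`, if `ρ̄|_{ℚ(√-3)}` is
absolutely irreducible and `ρ̄` is modular then `E` is modular (`BCDT.IsModular W`).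
[cite: DieulefaitPacetti2023, Thm. 1.4] -/
theorem stub_liftThree :
    ∀ (W : WeierstrassCurve ℚ) [W.IsElliptic] [NeZero (W.conductorNorm ℤ)]
      (ρ : ModPGaloisRep ℚ (ZMod 3) 2), W.IsTorsionGaloisRep 3 ρ →
      ρ.IsAbsIrreducibleOverSqrt (-3) → ρ.IsModular → IsModular W := by
  sorry

/-- **Stub LIFT(5)** = Conrad–Diamond–Taylor 1999, Thm. 7.2.2 (the tree's named fact
`CDT_theorem_7_2_2`). [cite: ConradDiamondTaylor1999, Thm. 7.2.2] -/
theorem stub_liftFive : CDT_theorem_7_2_2 := by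
  sorry

/-- **Stub (the `3`–`5` switch, torsion-only)**: for an elliptic `W/ℚ` none of whose framed
`ρ̄_{E,3}` is absolutely irreducible over `ℚ(√-3)`, and a framed model `ρ̄` of `E[5]` absolutely
irreducible over `ℚ(√5)`, there is an elliptic `W'/ℚ` with `W'[5] ≅ W[5]` (the same `ρ̄`) and some
framed `ρ̄_{E',3}` absolutely irreducible over `ℚ(√-3)` — `CDT_three_five_switch` without its idle
hypothesis `¬ 27 ∣ N_E`; implied by `exists_isTorsionGaloisRep_five_and_surjective_three`.
[cite: ConradDiamondTaylor1999, proof of Thm. 7.1.2 (p. 556)] -/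
theorem stub_switch :
    ∀ (W : WeierstrassCurve ℚ) [W.IsElliptic],
      (∀ ρ₃ : ModPGaloisRep ℚ (ZMod 3) 2, W.IsTorsionGaloisRep 3 ρ₃ →
        ¬ ρ₃.IsAbsIrreducibleOverSqrt (-3)) →
      ∀ (ρ : ModPGaloisRep ℚ (ZMod 5) 2), W.IsTorsionGaloisRep 5 ρ → ρ.IsAbsIrreducibleOverSqrt 5 →
      ∃ (W' : WeierstrassCurve ℚ) (_ : W'.IsElliptic), W'.IsTorsionGaloisRep 5 ρ ∧
        ∃ ρ₃' : ModPGaloisRep ℚ (ZMod 3) 2, W'.IsTorsionGaloisRep 3 ρ₃' ∧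
          ρ₃'.IsAbsIrreducibleOverSqrt (-3) := by
  sorry

/-- **Stub (CDT Lemma 7.2.3, modularity conclusion; Elkies)** = the tree's named fact
`CDT_lemma_7_2_3_isModular`. [cite: ConradDiamondTaylor1999, Lemma 7.2.3] -/
theorem stub_lemma723 : CDT_lemma_7_2_3_isModular := by
  sorry

/-- **The crux `ModularDatumExists` from the five stubs**: the LANDED composition
`modularDatumExists_of_modThree_of_liftThree_of_CDT722_of_switch_of_CDT723`
(`Theorems/IsogenyGlueCongruenceModularDatumExistsUniformLifting`, p97015: Wiles' case analysis in
the order of Conrad–Diamond–Taylor 1999, p. 556, with no conductor hypothesis anywhere) fed with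
the five registered stubs — the only `sorry`s of this file.
[cite: ConradDiamondTaylor1999, proof of Thm. 7.1.2 (p. 556)] -/
theorem ModularDatumExists_of : Summit.ABC.ABC.Theses.IsogenyGlueCongruence.ModularDatumExists :=
  modularDatumExists_of_modThree_of_liftThree_of_CDT722_of_switch_of_CDT723 stub_modThree
    stub_liftThree stub_liftFive stub_switch stub_lemma723

end Summit.ABC.ABC.Theorems

end
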